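import Literature.Computability.AlgebraicComplexity.BLMW11WeaklySkewDetProofs
import Literature.Computability.AlgebraicComplexity.SkewCircuitLinComb
import Literature.Computability.AlgebraicComplexity.StandardFamilies
import HarnessLib

/-!
# Iterated matrix multiplication by (weakly) skew circuits — `IMM ∈ VBP`
# (Bürgisser 2024 survey, Rem. 2.8(2); half of Cor. 2.24) — PROOFS

Topic `Computability/AlgebraicComplexity`. Cell `val-lit`, row Bur2024-A (P. Bürgisser,
*Completeness classes in algebraic complexity theory*, arXiv:2406.06217, 2024; held text
`paper:arxiv-2406.06217`, p0006 L28–L35):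

> **Remark 2.8(2).** The computation of the entries of the iterated matrix product `A_1 ⋯ A_d`
> from the entries of given `n × n` matrices `A_i`, based on the associativity relation
> `A_1 ⋯ A_d = B A_d` with `B = A_1 ⋯ A_{d−1}`, can be done by a skew circuit of size `O(d n³)`.
> The reason is that for computing the products `B_{ij} (A_d)_{jℓ}`, the circuit can directly
> access the input variables `(A_d)_{jℓ}`.

Typed with the tree's skew-circuit compiler for branching programs (`HI16Skew.abpCircuit`,
Malod–Portier 2008, proof of Prop. 5; `HI16SkewCircuitsProofs.lean`): the layered branching
program of `A_1 ⋯ A_d` is the block matrix `N` on `Fin (d+1) × Fin n` with the generic matrix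
`X^{(t)}` between layers `t` and `t+1` (`layerMatrix`); `(N^s)_{(0,i),(t,ℓ)} = [t = s] ·
(X^{(0)} ⋯ X^{(s−1)})_{iℓ}` (`layerMatrix_pow_apply`), so the program value
`e_{(0,i)} · (∑_{j ≤ d} (−N)^j) · (−1)^d e_{(d,ℓ)}` is the entry `(X^{(0)} ⋯ X^{(d−1)})_{iℓ}` of
the tree's `immMatrix (Fin n) d k` (`StandardFamilies.lean`). Results:

* `exists_wsCircuit_immMatrix_entry` — every entry of `immMatrix (Fin n) d k` has a well-formed,
  fan-in-two, constant-free, skew and weakly-skew circuit of size `≤ (d+2) · (2(d+1)n + 3)²`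
  (the printed bound is `O(d n³)`; the generic compiler gives this weaker polynomial bound —
  TODO(sharper form): the direct associativity circuit of Rem. 2.8(2));
* `skewComplexity_immMatrix_entry_le`, `wsComplexity_immMatrix_entry_le`, and for the trace
  `immPoly n d k = tr(X^{(0)} ⋯ X^{(d−1)})`: `wsComplexity_immPoly_le`;
* `isVPwsFamily_immPoly` — **`IMM ∈ VBP`**: for every `c`, `n ↦ IMM_{n^c, n}` is a `VP_ws`
  family (the membership half of Bürgisser 2024, Cor. 2.24 "`(IMM_{n,n})`, `(DET_n)` are
  `VBP`-complete"; the hardness half is not typed here).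

Theorems (and definitions with bodies) only; no named facts, no `sorry` (D-0026). Honest framing:
a textbook upper bound; `VP ≠ VNP` is NOT proved and nothing here bears on it.
-/

namespace Literature.Computability.AlgebraicComplexity

open MvPolynomial Matrix

universe u

namespace IMMSkew

open ArithCircuit HI16Skew

variable (k : Type u) [CommRing k] (n d : ℕ)

/-- The generic matrix `X^{(t)} = (X_{(t,j,l)})_{j,l}` of layer `t`. [cite: Burgisser2024Completeness, Rem. 2.8(2)] -/
noncomputable def layerX (t : Fin d) : Matrix (Fin n) (Fin n) (MvPolynomial (Fin d × Fin n × Fin n) k) :=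
  (Matrix.mvPolynomialX (Fin n) (Fin n) k).map (rename fun ij : Fin n × Fin n => (t, ij))

/-- Entries of `layerX`. [cite: Burgisser2024Completeness, Rem. 2.8(2)] -/
@[simp]
theorem layerX_apply (t : Fin d) (j l : Fin n) : layerX k n d t j l = X (t, j, l) := by
  simp [layerX, Matrix.map_apply, Matrix.mvPolynomialX_apply, rename_X]

/-- The prefix products `X^{(0)} ⋯ X^{(s−1)}` (`s ≤ d`). [cite: Burgisser2024Completeness, Rem. 2.8(2)] -/
noncomputable def prefixProd (s : ℕ) : Matrix (Fin n) (Fin n) (MvPolynomial (Fin d × Fin n × Fin n) k) :=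
  (((List.finRange d).take s).map (layerX k n d)).prod

/-- `prefixProd 0 = 1`. [cite: Burgisser2024Completeness, Rem. 2.8(2)] -/
@[simp]
theorem prefixProd_zero : prefixProd k n d 0 = 1 := by
  simp [prefixProd]

/-- `prefixProd (s+1) = prefixProd s · X^{(s)}` for `s < d` (the associativity relation of
Rem. 2.8(2)). [cite: Burgisser2024Completeness, Rem. 2.8(2)] -/
theorem prefixProd_succ {s : ℕ} (hs : s < d) :
    prefixProd k n d (s + 1) = prefixProd k n d s * layerX k n d ⟨s, hs⟩ := by
  unfold prefixProd
  rw [List.take_add_one, List.getElem?_eq_getElem (by simpa using hs), List.getElem_finRange,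
    Option.toList_some, List.map_append, List.prod_append, List.map_singleton, List.prod_singleton]
  rfl

/-- The full product is the tree's `immMatrix`. [cite: LimayeSrinivasanTavenas2021, §2] -/
theorem prefixProd_eq_immMatrix : prefixProd k n d d = immMatrix (Fin n) d k := by
  unfold prefixProd immMatrix layerX
  rw [List.take_of_length_le (by simp)]

/-- **The layered branching program of `A_1 ⋯ A_d`**: the block matrix on `Fin (d+1) × Fin n`
whose only nonzero blocks are the generic matrices `X^{(t)}` from layer `t` to layer `t+1`.
[cite: Burgisser2024Completeness, Rem. 2.8(2)] -/
noncomputable def layerMatrix :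
    Matrix (Fin (d + 1) × Fin n) (Fin (d + 1) × Fin n) (MvPolynomial (Fin d × Fin n × Fin n) k) :=
  fun v w => if h : v.1.val + 1 = w.1.val then
    X (⟨v.1.val, by have := w.1.isLt; omega⟩, v.2, w.2) else 0

/-- The entries of `layerMatrix` out of layer `s < d`. [cite: Burgisser2024Completeness, Rem. 2.8(2)] -/
theorem layerMatrix_apply_of_lt {s : ℕ} (hs : s < d) (j : Fin n) (w : Fin (d + 1) × Fin n) :
    layerMatrix k n d (⟨s, by omega⟩, j) w =
      if w.1.val = s + 1 then layerX k n d ⟨s, hs⟩ j w.2 else 0 := by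
  unfold layerMatrix
  by_cases h : s + 1 = w.1.val
  · rw [dif_pos h, if_pos h.symm, layerX_apply]
  · rw [dif_neg h, if_neg (fun h' => h h'.symm)]

/-- **Powers of the layered matrix**: `(N^s)_{(0,i),(t,ℓ)} = [t = s] · (X^{(0)} ⋯ X^{(s−1)})_{iℓ}`
for `s ≤ d`. [cite: Burgisser2024Completeness, Rem. 2.8(2)] -/
theorem layerMatrix_pow_apply (s : ℕ) (hs : s ≤ d) (i : Fin n) (w : Fin (d + 1) × Fin n) :
    (layerMatrix k n d ^ s) ((0 : Fin (d + 1)), i) w =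
      if w.1.val = s then prefixProd k n d s i w.2 else 0 := by
  induction s generalizing w with
  | zero =>
    obtain ⟨t, l⟩ := w
    simp only [pow_zero, Matrix.one_apply, prefixProd_zero, Prod.mk.injEq]
    by_cases h1 : (0 : Fin (d + 1)) = t ∧ i = l
    · obtain ⟨rfl, rfl⟩ := h1
      simp
    · rw [if_neg h1]
      by_cases h2 : (t : ℕ) = 0
      · have ht : t = 0 := Fin.ext h2
        subst ht
        simp only [true_and] at h1
        simp [h1]
      · simp [h2]
  | succ s ih =>
    have hs' : s < d := by omega
    rw [pow_succ, Matrix.mul_apply, Fintype.sum_prod_type,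
      Finset.sum_eq_single (⟨s, by omega⟩ : Fin (d + 1))]
    · simp only [ih (by omega), if_true, layerMatrix_apply_of_lt k n d hs']
      by_cases hw : w.1.val = s + 1
      · simp only [if_pos hw, prefixProd_succ k n d hs', Matrix.mul_apply]
      · simp [if_neg hw]
    · intro t _ ht
      have hts : t.val ≠ s := fun h => ht (Fin.ext h)
      simp [ih (by omega), if_neg hts]
    · intro h; exact absurd (Finset.mem_univ _) h

/-- Signs: `((−N)^j)_{vw} = (−1)^j (N^j)_{vw}`. [folklore] -/
private theorem neg_pow_apply {V : Type*} [Fintype V] [DecidableEq V] {R : Type*} [CommRing R]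
    (N : Matrix V V R) (j : ℕ) (v w : V) : ((-N) ^ j) v w = (-1) ^ j * (N ^ j) v w := by
  rw [neg_pow]
  rcases Nat.even_or_odd j with hj | hj
  · rw [hj.neg_one_pow, hj.neg_one_pow, one_mul, one_mul]
  · rw [hj.neg_one_pow, hj.neg_one_pow, neg_one_mul, neg_one_mul, Matrix.neg_apply]

/-- **The program value**: the `((0,i),(d,ℓ))` entry of `∑_{j ≤ d} (−N)^j` is
`(−1)^d (X^{(0)} ⋯ X^{(d−1)})_{iℓ}`. [cite: Burgisser2024Completeness, Rem. 2.8(2)] -/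
theorem geomInv_layerMatrix_apply (i ℓ : Fin n) :
    GKKP2011.geomInv (layerMatrix k n d) (d + 1) ((0 : Fin (d + 1)), i) (Fin.last d, ℓ) =
      (-1) ^ d * immMatrix (Fin n) d k i ℓ := by
  unfold GKKP2011.geomInv
  rw [Matrix.sum_apply, Finset.sum_eq_single d]
  · rw [neg_pow_apply, layerMatrix_pow_apply k n d d le_rfl, if_pos (by simp), prefixProd_eq_immMatrix]
  · intro j hj hjd
    have hj' : j ≤ d := by have := Finset.mem_range.1 hj; omega
    rw [neg_pow_apply, layerMatrix_pow_apply k n d j hj', if_neg (by simp; omega), mul_zero]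
  · intro h; exact absurd (Finset.mem_range.2 (Nat.lt_succ_self d)) h

/-! ## The program data (weights `X_{(t,j,l)}`, `0`, `1`, `(−1)^d`) -/

/-- Edge weights: `X_{(t,j,l)}` from `(t,j)` to `(t+1,l)`, else `0 · 1`.
[cite: MalodPortier2008, Prop. 5 (proof)] -/
noncomputable def edgeRepr (v w : Fin (d + 1) × Fin n) : k × Operand k (Fin d × Fin n × Fin n) :=
  if h : v.1.val + 1 = w.1.val then
    (1, .var (⟨v.1.val, by have := w.1.isLt; omega⟩, v.2, w.2))
  else (0, .const 1)

/-- Source weights: `1` at `(0, i)`, else `0`. [cite: MalodPortier2008, Prop. 5 (proof)] -/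
noncomputable def srcRepr (i : Fin n) (v : Fin (d + 1) × Fin n) :
    k × Operand k (Fin d × Fin n × Fin n) :=
  (if v = ((0 : Fin (d + 1)), i) then 1 else 0, .const 1)

/-- Sink weights: `(−1)^d` at `(d, ℓ)`, else `0`. [cite: MalodPortier2008, Prop. 5 (proof)] -/
noncomputable def snkRepr (ℓ : Fin n) (v : Fin (d + 1) × Fin n) :
    k × Operand k (Fin d × Fin n × Fin n) :=
  (if v = (Fin.last d, ℓ) then (-1) ^ d else 0, .const 1)

/-- The edge weights represent `layerMatrix`. [cite: MalodPortier2008, Prop. 5 (proof)] -/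
theorem reprVal_edgeRepr (v w : Fin (d + 1) × Fin n) :
    layerMatrix k n d v w = reprVal (edgeRepr k n d v w) := by
  unfold edgeRepr layerMatrix reprVal ival
  by_cases h : v.1.val + 1 = w.1.val
  · rw [dif_pos h, dif_pos h]
    simp [Operand.eval]
  · rw [dif_neg h, dif_neg h]
    simp

/-- The edge weights are admissible. [cite: MalodPortier2008, Prop. 5 (proof)] -/
theorem reprOk_edgeRepr (v w : Fin (d + 1) × Fin n) : ReprOk (edgeRepr k n d v w) := by
  unfold edgeRepr
  split_ifs
  · exact ⟨isSignConstant_one, rfl, trivial⟩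
  · exact ⟨isSignConstant_zero, rfl, isSignConstant_one⟩

/-- `(c, const 1)` represents the constant `c`. [folklore] -/
private theorem reprVal_const_one (c : k) :
    reprVal ((c, .const 1) : k × Operand k (Fin d × Fin n × Fin n)) = C c := by
  simp [reprVal, ival, Operand.eval, smul_eq_C_mul]

/-- The source weights are admissible. [cite: MalodPortier2008, Prop. 5 (proof)] -/
theorem reprOk_srcRepr (i : Fin n) (v : Fin (d + 1) × Fin n) : ReprOk (srcRepr k n d i v) := by
  unfold srcRepr
  split_ifs
  · exact ⟨isSignConstant_one, rfl, isSignConstant_one⟩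
  · exact ⟨isSignConstant_zero, rfl, isSignConstant_one⟩

/-- `(−1)^d` is a sign constant. [folklore] -/
private theorem isSignConstant_neg_one_pow (m : ℕ) : IsSignConstant ((-1 : k) ^ m) := by
  rcases Nat.even_or_odd m with h | h
  · rw [h.neg_one_pow]; exact isSignConstant_one
  · rw [h.neg_one_pow]; exact isSignConstant_neg_one

/-- The sink weights are admissible. [cite: MalodPortier2008, Prop. 5 (proof)] -/
theorem reprOk_snkRepr (ℓ : Fin n) (v : Fin (d + 1) × Fin n) : ReprOk (snkRepr k n d ℓ v) := by
  unfold snkRepr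
  split_ifs
  · exact ⟨isSignConstant_neg_one_pow k _, rfl, isSignConstant_one⟩
  · exact ⟨isSignConstant_zero, rfl, isSignConstant_one⟩

/-- **The value of the branching program is the IMM entry**:
`e_{(0,i)} · (∑_{j≤d} (−N)^j) · (−1)^d e_{(d,ℓ)} = (X^{(0)} ⋯ X^{(d−1)})_{iℓ}`.
[cite: Burgisser2024Completeness, Rem. 2.8(2)] -/
theorem programValue_eq (i ℓ : Fin n) :
    (fun v => reprVal (srcRepr k n d i v)) ⬝ᵥ
        (GKKP2011.geomInv (layerMatrix k n d) (d + 1)).mulVec (fun v => reprVal (snkRepr k n d ℓ v)) =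
      immMatrix (Fin n) d k i ℓ := by
  have ha : (fun v => reprVal (srcRepr k n d i v)) =
      fun v => if v = ((0 : Fin (d + 1)), i) then (1 : MvPolynomial _ k) else 0 := by
    funext v
    unfold srcRepr
    rw [reprVal_const_one]
    split_ifs <;> simp
  have hb : (fun v => reprVal (snkRepr k n d ℓ v)) =
      fun v => if v = (Fin.last d, ℓ) then ((-1) ^ d : MvPolynomial _ k) else 0 := by
    funext v
    unfold snkRepr
    rw [reprVal_const_one]
    split_ifs <;> simp
  rw [ha, hb]
  simp only [dotProduct, ite_mul, one_mul, zero_mul, Finset.sum_ite_eq', Finset.mem_univ,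
    if_true, Matrix.mulVec, dotProduct, mul_ite, mul_zero]
  rw [geomInv_layerMatrix_apply]
  rw [mul_comm ((-1 : MvPolynomial _ k) ^ d) _, mul_assoc, ← pow_add,
    (Even.add_self d).neg_one_pow, mul_one]

/-! ## The circuit -/

/-- Truncating junk references keeps a gate skew. [folklore] -/
private theorem isSkew_truncate' {σ : Type*} {g : Gate k σ} (hg : g.IsSkew) (m : ℕ) :
    (g.truncate m).IsSkew := by
  cases g with
  | sum args => trivial
  | prod args =>
    show (args.map (Operand.truncate m)).countP Operand.isGateRef ≤ 1
    rw [List.countP_map]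
    refine le_trans (List.countP_mono_left fun u _ h => ?_) hg
    cases u with
    | var i => exact h
    | const c => exact h
    | gate j => rfl

/-- `trimJunk` keeps a circuit skew. [folklore] -/
private theorem isSkew_trimJunk' {σ : Type*} {P : ArithCircuit k σ} (hP : P.IsSkew) :
    P.trimJunk.IsSkew := by
  intro g hg
  simp only [ArithCircuit.trimJunk, List.mem_mapIdx] at hg
  obtain ⟨i, hi, rfl⟩ := hg
  exact isSkew_truncate' k (hP _ (List.getElem_mem hi)) _

/-- Truncation keeps an input operand of a product gate. [folklore] -/
private theorem hasInputFactor_truncate' {σ : Type*} {g : Gate k σ}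
    (hg : ∀ args, g = Gate.prod args → ∃ u ∈ args, u.isGateRef = false) (m : ℕ) :
    ∀ args, g.truncate m = Gate.prod args → ∃ u ∈ args, u.isGateRef = false := by
  intro args h
  cases g with
  | sum as => exact absurd h (by simp [Gate.truncate])
  | prod as =>
    obtain ⟨u, hu, hu'⟩ := hg as rfl
    simp only [Gate.truncate, Gate.prod.injEq] at h
    subst h
    refine ⟨u.truncate m, List.mem_map.2 ⟨u, hu, rfl⟩, ?_⟩
    cases u with
    | var i => rfl
    | const c => rfl
    | gate j => simp [Operand.isGateRef] at hu'

/-- **Bürgisser 2024, Rem. 2.8(2): the entries of the iterated matrix product have small skew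
circuits.** Every entry of `X^{(0)} ⋯ X^{(d−1)}` (generic `n × n` matrices, the tree's
`immMatrix (Fin n) d k`) is computed by a well-formed, fan-in-two, constant-free, skew and
weakly-skew circuit of size `≤ (d+2) · (2(d+1)n + 3)²` (print: `O(d n³)` by the direct
associativity circuit; here the generic branching-program compiler `HI16Skew.abpCircuit`).
[cite: Burgisser2024Completeness, Rem. 2.8(2)] [cite: MalodPortier2008, Prop. 5 (proof)] -/
theorem exists_wsCircuit_immMatrix_entry (i ℓ : Fin n) :
    ∃ P : ArithCircuit k (Fin d × Fin n × Fin n), P.WellFormed ∧ P.IsFanInTwo ∧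
      P.HasSignConstants ∧ P.IsSkew ∧ P.IsWeaklySkew ∧ P.eval = immMatrix (Fin n) d k i ℓ ∧
      P.size ≤ (d + 2) * (2 * ((d + 1) * n) + 3) ^ 2 := by
  classical
  obtain ⟨h1, h2, h3, h4, h5⟩ := abpCircuit_spec (reprOk_edgeRepr k n d) (reprOk_snkRepr k n d ℓ)
    (reprOk_srcRepr k n d i) (layerMatrix k n d) (fun v => reprVal (srcRepr k n d i v))
    (fun v => reprVal (snkRepr k n d ℓ v)) (reprVal_edgeRepr k n d) (fun _ => rfl) (fun _ => rfl)
    (d + 1)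
  have hin := abpCircuit_hasInputFactor (reprOk_edgeRepr k n d) (reprOk_snkRepr k n d ℓ)
    (reprOk_srcRepr k n d i) (Finset.univ : Finset (Fin (d + 1) × Fin n)).toList (d + 1)
  refine ⟨(abpCircuit (edgeRepr k n d) (snkRepr k n d ℓ) (srcRepr k n d i) Finset.univ.toList
      (d + 1)).trimJunk, wellFormed_trimJunk _, h1.trimJunk, h2.trimJunk, isSkew_trimJunk' k h3,
    ?_, ?_, ?_⟩
  · refine isWeaklySkew_of_hasInputFactor fun g hg => ?_
    simp only [ArithCircuit.trimJunk, List.mem_mapIdx] at hg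
    obtain ⟨j, hj, rfl⟩ := hg
    exact hasInputFactor_truncate' k (hin _ (List.getElem_mem hj)) _
  · rw [eval_trimJunk, h4, programValue_eq]
  · rw [size_trimJunk]
    rw [Fintype.card_prod, Fintype.card_fin, Fintype.card_fin] at h5
    calc (abpCircuit (edgeRepr k n d) (snkRepr k n d ℓ) (srcRepr k n d i) Finset.univ.toList
          (d + 1)).size ≤ (d + 1 + 1) * (2 * ((d + 1) * n) + 3) ^ 2 := h5
      _ = (d + 2) * (2 * ((d + 1) * n) + 3) ^ 2 := by ring

/-- `L_skew` of an IMM entry is at most `(d+2)(2(d+1)n+3)²`. [cite: Burgisser2024Completeness, Rem. 2.8(2)] -/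
theorem skewComplexity_immMatrix_entry_le (i ℓ : Fin n) :
    skewComplexity (immMatrix (Fin n) d k i ℓ) ≤ (d + 2) * (2 * ((d + 1) * n) + 3) ^ 2 := by
  obtain ⟨P, hwf, h2, -, hsk, -, hev, hsz⟩ := exists_wsCircuit_immMatrix_entry k n d i ℓ
  exact (skewComplexity_le_size P hwf h2 hsk hev).trans hsz

/-- `L_ws` of an IMM entry is at most `(d+2)(2(d+1)n+3)²`. [cite: Burgisser2024Completeness, Rem. 2.8(2)] -/
theorem wsComplexity_immMatrix_entry_le (i ℓ : Fin n) :
    wsComplexity (immMatrix (Fin n) d k i ℓ) ≤ (d + 2) * (2 * ((d + 1) * n) + 3) ^ 2 := by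
  obtain ⟨P, hwf, h2, -, -, hws, hev, hsz⟩ := exists_wsCircuit_immMatrix_entry k n d i ℓ
  exact (wsComplexity_le_size P hwf h2 hws hev).trans hsz

/-- **`L_ws(IMM_{n,d}) ≤ n · 4 (d+2)(2(d+1)n+3)² + n + 1`** for the trace form
`immPoly n d k = tr(X^{(0)} ⋯ X^{(d−1)})` (sum of the `n` diagonal entries, `wsComplexity_sum_smul_le`).
[cite: Burgisser2024Completeness, Rem. 2.8(2)] -/
theorem wsComplexity_immPoly_le :
    wsComplexity (immPoly n d k) ≤ n * (4 * ((d + 2) * (2 * ((d + 1) * n) + 3) ^ 2)) + (n + 1) := by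
  have htr : immPoly n d k = ∑ i : Fin n, (1 : k) • immMatrix (Fin n) d k i i := by
    simp [immPoly, Matrix.trace, Matrix.diag]
  rw [htr]
  refine (wsComplexity_sum_smul_le _ _ _).trans ?_
  rw [Finset.card_univ, Fintype.card_fin]
  gcongr with i
  · calc ∑ i : Fin n, 4 * wsComplexity (immMatrix (Fin n) d k i i)
        ≤ ∑ _i : Fin n, 4 * ((d + 2) * (2 * ((d + 1) * n) + 3) ^ 2) :=
          Finset.sum_le_sum fun i _ => Nat.mul_le_mul_left 4 (wsComplexity_immMatrix_entry_le k n d i i)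
      _ = n * (4 * ((d + 2) * (2 * ((d + 1) * n) + 3) ^ 2)) := by
          rw [Finset.sum_const, Finset.card_univ, Fintype.card_fin, smul_eq_mul]

end IMMSkew

/-! ## `IMM ∈ VBP` (the membership half of Bürgisser 2024, Cor. 2.24) -/

section Classes

open IMMSkew

/-- **`(IMM_{n^c, n})_n ∈ VBP = VP_ws`** for every `c` (Bürgisser 2024, Rem. 2.8(2), and the
membership half of Cor. 2.24: "`(IMM_{n,n})` and `(DET_n)` are `VBP`-complete"; the tree's IMM
family is `n ↦ immPoly (n^c) n k`, cf. `isVPFamily_immPoly`). The hardness half (every `VBP`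
family is a p-projection of `IMM`) is not typed here. [cite: Burgisser2024Completeness, Cor. 2.24] -/
theorem isVPwsFamily_immPoly (k : Type u) [CommRing k] (c : ℕ) :
    IsVPwsFamily fun n => immPoly (n ^ c) n k := by
  have hB : IsPBounded fun n : ℕ =>
      n ^ c * (4 * ((n + 2) * (2 * ((n + 1) * n ^ c) + 3) ^ 2)) + (n ^ c + 1) := by
    have hc : IsPBounded fun n : ℕ => n ^ c := IsPBounded.pow_holds IsPBounded.id c
    have hid : IsPBounded fun n : ℕ => n := IsPBounded.id
    refine IsPBounded.add_holds (IsPBounded.mul_holds hc (IsPBounded.mul_holds (IsPBounded.const 4)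
      (IsPBounded.mul_holds (IsPBounded.add_holds hid (IsPBounded.const 2))
        (IsPBounded.pow_holds (IsPBounded.add_holds (IsPBounded.mul_holds (IsPBounded.const 2)
          (IsPBounded.mul_holds (IsPBounded.add_holds hid (IsPBounded.const 1)) hc))
          (IsPBounded.const 3)) 2))))
      (IsPBounded.add_holds hc (IsPBounded.const 1))
  exact hB.mono fun n => wsComplexity_immPoly_le k (n ^ c) n

end Classes

end Literature.Computability.AlgebraicComplexity
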